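import Summits.BirchSwinnertonDyer.Rank1Residual.WAll.TargetPrimeSlices
import HarnessLib
import HarnessLib.Audit.Tags

/-!
# Rung W-ALL of ladder BSD (D-0120) — row 2 AT `p = 3` sliced by CENSUS CELL × RANK
# (cell `bsd-wall`, lane (2), seat `bsd-wall-ty-1`; new small file importing `WAll.TargetPrimeSlices`)

HONEST FRAMING (cell `bsd-wall`, run/shared/lean/pub/bsd-wall/; brief `WALL-BRIEF-v1.md` sha16
b966bf16da27706e §2; WALL-TABLE.md v1.8 row 2): STATEMENTS AND BOOKKEEPING ONLY — nothing asserted,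
nothing booked, no named fact, no published theorem restated; every `@[conjecture] def` below is an
OPEN obligation and a SLICE of the already-registered row-2 leaves `WAllExclAdditive` (`Target.lean`),
`WAllExclAdditiveAtThree[RankZero|RankOne]` (`TargetPrimeSlices.lean`) and of the cell leaves
`WAllExclAdd{PotMult,PotOrd,TameSS,Gss,Tprime,Wild}` (`TargetAdditive.lean`).

WHY THIS GRANULARITY. The census of record (CENSUS-EXCLUSIONS-v1.1, register A2 ROUND 494,
`N < 5·10⁵`, unit = isogeny class) puts the largest W-ALL residue block at row 2 × `p = 3`: `43 039`
of `79 001` residue cells (54 %) — X3 `r = 0` `13 583` + X3 `r = 1` `14 189` + X4 `r = 0` `7 591` +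
X4 `r = 1` `7 676`, so `r = 0` : `21 174`, `r = 1` : `21 865` (lead line 2026-08-27T05:46:40Z; cell
shares inside `p = 3` are instrument-level). The director's ROW-2-AT-3 scoping (05:44:47Z, addendum
06:08:29Z) reads that block by CENSUS CELL — (M) potentially multiplicative · (G-ord) (at `3`:
`e = 2`, `Additive.not_subGordHigher_three`) · tame potentially supersingular (O5 = `(G) ∧ ss`,
`e = 2`, ∪ `(t′)`, `e = 4`) · wild (O6, `e ∈ {3, 6, 12}`) — × RANK, and a sub-block route must be
able to `--closes-target` exactly its block. The tree's routes at `3` already cut this way (K1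
`AdditiveBranchIMC` on (M) ∪ (G-ord) by rank; K9 / K8-t′ Kato descent on O6 / `(t′)` in rank `0` with
HELD rank-`1` residuals `WildRankOne` 19200 / `TameRankOne` 19984; K8's held `Gss2AtThree` 19120; W2
`KimAtThreeKolyvagin` in rank `0` across the cells). This file
NAMES the cell × rank blocks at `3` as Theses-free BSDp-shaped `Prop`s (binder order as in
`WAllExclAdditiveAtThree` and the cell leaves), PROVES that the `p = 3` slice of row 2 — and each of
its rank slices — is EXACTLY the conjunction of its cell atoms (`Additive.addv_odd_cells W 3`,
`r ≤ 1 ↔ r = 0 ∨ r = 1`; no mathematics), and records the three held residual items as closers BY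
NAME of their BSDp twins (currency `Typed.MissingPPartAt`; bridge `Typed.bsdp_of_missingPPartAt` + GZK).

| cell at `p = 3` | `r ≤ 1` | `r = 0` | `r = 1` |
|---|---|---|---|
| (M) `Additive.SubM W 3` | `WAllExclAddPotMultAtThree` | `…PotMultAtThreeRankZero` | `…PotMultAtThreeRankOne` |
| (G-ord) `Additive.SubGordOrd W 3` | `WAllExclAddPotOrdAtThree` | `…PotOrdAtThreeRankZero` | `…PotOrdAtThreeRankOne` |
| O5 tame pot-ss `Additive.ClassO5 W 3` | `WAllExclAddTameSSAtThree` | `…TameSSAtThreeRankZero` | `…TameSSAtThreeRankOne` |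
| O5, `(G) ∧ ss` part `Additive.SubGss W 3` | `WAllExclAddGssAtThree` (twin of 19120) | — | — |
| O5, `(t′)` part `Additive.SubTprime W 3` | `WAllExclAddTprimeAtThree` | `…TprimeAtThreeRankZero` | `…TprimeAtThreeRankOne` (twin of 19984 at `3`) |
| O6 wild `Additive.ClassO6 W 3` | `WAllExclAddWild` (`TargetAdditive.lean`; `p = 3` forced) | `WAllExclAddWildRankZero` | `WAllExclAddWildRankOne` (twin of 19200) |

NOT RESTATED: the `p = 3` slice and its rank slices (`TargetPrimeSlices.lean`), the wild cell
(`WAllExclAddWild`, a `p = 3` statement by `wAllExclAddWild_iff_three`), the cells at all odd `p`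
(`TargetAdditive.lean`), sub-rows 2f (Kim-at-3: an IMAGE condition across cells; rung-W2 leaf
`N11.KimAtThreeRankZeroPUB` closes PER PAIR only) and 2g (X3 = reducible: `WAllExclX3`).

References: `WAll/Target.lean`, `WAll/TargetAdditive.lean`, `WAll/TargetPrimeSlices.lean`,
`WAll/Conjunction.lean`; `WAll/AltClosersAdditiveCells.lean` §3 (`exclAdditiveAtThree_of_leaves`: the
`p = 3` slice ⇐ K1 + the upper half on `N10.Locus` at `3` + K8 + K9-tame + K9-wild + GZK);
`Additive/PotSupersingularClasses.lean` (`addv_odd_cells`, `ClassO5`, `ClassO6`),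
`Additive/PotSupersingularTargets.lean`, `Additive/SubGordThree.lean` (`not_subGordHigher_three`);
WALL-BRIEF-v1.md §2; [cite: Delbourgo1998, §1.5 (G) and Thm. 1] (the (G)/(M)/(t′) vocabulary);
[cite: Miller2011LMS, §1 and Def. 1.1] (the currency `BSD(E,p)`).
-/

noncomputable section

open scoped Classical

open WeierstrassCurve Literature.NumberTheory.EllipticCurves
  Literature.NumberTheory.EllipticCurves.Rank1Residual Literature.NumberTheory.EllipticCurves.ModularForms
open Summit.BirchSwinnertonDyer.Rank1Residual

set_option autoImplicit false

namespace Summit.BirchSwinnertonDyer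

/-! ### §1. The four census cells of row 2 at `p = 3`, rank `≤ 1` -/

/-- **Row 2e at `p = 3` — potentially multiplicative (OPEN).** Non-CM `E/ℚ` (globally minimal `W`),
additive at `3` with `ord₃ j(E) < 0` (cell (M), `Additive.SubM`: Kodaira `Iₙ*`, `n ≥ 1`, the
ramified quadratic twist of a Tate curve), `r ≤ 1` ⇒ `BSD(E,3)`. The `p = 3` instance of
`WAllExclAddPotMult`; K1 territory (`MultLower` children). [folklore] -/
@[conjecture] def WAllExclAddPotMultAtThree : Prop :=
  ∀ (W : WeierstrassCurve ℚ) [W.IsElliptic] [W.IsGloballyMinimal],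
    ¬ W.HasCM → Addv W 3 → Additive.SubM W 3 → W.analyticRank ≤ 1 → BSDp W 3

/-- **Row 2a at `p = 3` — potentially good ORDINARY of Delbourgo's type (G) (OPEN).** Non-CM,
additive at `3`, cell (G-ord) (`Additive.SubGordOrd`; at `3` the cell (G) is entirely `e = 2`,
Kodaira `I₀*`, `E` = the `χ_{−3}`-twist of a good ORDINARY curve: `Additive.not_subGordHigher_three`),
`r ≤ 1` ⇒ `BSD(E,3)`. The `p = 3` instance of `WAllExclAddPotOrd`; K1 territory (`GordTwo…` items).
[cite: Delbourgo1998, §1.5 (G) and Thm. 1] -/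
@[conjecture] def WAllExclAddPotOrdAtThree : Prop :=
  ∀ (W : WeierstrassCurve ℚ) [W.IsElliptic] [W.IsGloballyMinimal],
    ¬ W.HasCM → Addv W 3 → Additive.SubGordOrd W 3 → W.analyticRank ≤ 1 → BSDp W 3

/-- **Rows 2b ∪ 2c at `p = 3` — TAME potentially SUPERSINGULAR, class O5 (OPEN).** Non-CM,
`Additive.ClassO5 W 3` (additive at `3`, `(G) ∧ ss` with `e = 2` or `(t′)` with `e = 4`), `r ≤ 1`
⇒ `BSD(E,3)`. The `p = 3` instance of `WAllExclAddTameSS`; K8 / K8-t′ territory. [folklore] -/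
@[conjecture] def WAllExclAddTameSSAtThree : Prop :=
  ∀ (W : WeierstrassCurve ℚ) [W.IsElliptic] [W.IsGloballyMinimal],
    ¬ W.HasCM → Additive.ClassO5 W 3 → W.analyticRank ≤ 1 → BSDp W 3

/-- Row 2b at `p = 3` — the quadratic branch `(G) ∧ ss` (OPEN): non-CM, additive at `3`,
`Additive.SubGss W 3` (`e = 2`, `E` = the `χ_{−3}`-twist of a good SUPERSINGULAR curve, `a₃ ∈ {0, ±3}`),
`r ≤ 1` ⇒ `BSD(E,3)`. BSDp twin of rung K8's held residual item 19120 `Gss2AtThree`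
(`wAllExclAddGssAtThree_of_gss2AtThree`). [folklore] -/
@[conjecture] def WAllExclAddGssAtThree : Prop :=
  ∀ (W : WeierstrassCurve ℚ) [W.IsElliptic] [W.IsGloballyMinimal],
    ¬ W.HasCM → Addv W 3 → Additive.SubGss W 3 → W.analyticRank ≤ 1 → BSDp W 3

/-- Row 2c at `p = 3` — the tame branch `(t′)` (OPEN): non-CM, additive at `3`,
`Additive.SubTprime W 3` (`ord₃ j ≥ 0`, `f₃ = 2`, `e ∤ 2`, i.e. `e = 4`, Kodaira III / III*), `r ≤ 1`
⇒ `BSD(E,3)`. The `p = 3` instance of `WAllExclAddTprime`; K8-t′ territory. [folklore] -/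
@[conjecture] def WAllExclAddTprimeAtThree : Prop :=
  ∀ (W : WeierstrassCurve ℚ) [W.IsElliptic] [W.IsGloballyMinimal],
    ¬ W.HasCM → Addv W 3 → Additive.SubTprime W 3 → W.analyticRank ≤ 1 → BSDp W 3

/-! ### §2. The cell × rank atoms at `p = 3` -/

/-- (M) at `3`, rank `0` (OPEN): non-CM, additive at `3`, `ord₃ j < 0`, `ord_{s=1} L(E,s) = 0` ⇒
`BSD(E,3)`. [folklore] -/
@[conjecture] def WAllExclAddPotMultAtThreeRankZero : Prop :=
  ∀ (W : WeierstrassCurve ℚ) [W.IsElliptic] [W.IsGloballyMinimal],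
    ¬ W.HasCM → Addv W 3 → Additive.SubM W 3 → W.analyticRank = 0 → BSDp W 3

/-- (M) at `3`, rank `1` (OPEN): non-CM, additive at `3`, `ord₃ j < 0`, `ord_{s=1} L(E,s) = 1` ⇒
`BSD(E,3)`. [folklore] -/
@[conjecture] def WAllExclAddPotMultAtThreeRankOne : Prop :=
  ∀ (W : WeierstrassCurve ℚ) [W.IsElliptic] [W.IsGloballyMinimal],
    ¬ W.HasCM → Addv W 3 → Additive.SubM W 3 → W.analyticRank = 1 → BSDp W 3

/-- (G-ord) at `3`, rank `0` (OPEN): non-CM, additive at `3`, cell (G-ord), `ord_{s=1} L(E,s) = 0`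
⇒ `BSD(E,3)` (K1 items `GordTwoRankZeroOffCaseOne{Even,Odd}` territory). [folklore] -/
@[conjecture] def WAllExclAddPotOrdAtThreeRankZero : Prop :=
  ∀ (W : WeierstrassCurve ℚ) [W.IsElliptic] [W.IsGloballyMinimal],
    ¬ W.HasCM → Addv W 3 → Additive.SubGordOrd W 3 → W.analyticRank = 0 → BSDp W 3

/-- (G-ord) at `3`, rank `1` (OPEN): non-CM, additive at `3`, cell (G-ord), `ord_{s=1} L(E,s) = 1`
⇒ `BSD(E,3)` (K1 items `GordTwoLambda{Even,Odd}` / `GordTwoRankOneClassCert` territory). [folklore] -/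
@[conjecture] def WAllExclAddPotOrdAtThreeRankOne : Prop :=
  ∀ (W : WeierstrassCurve ℚ) [W.IsElliptic] [W.IsGloballyMinimal],
    ¬ W.HasCM → Addv W 3 → Additive.SubGordOrd W 3 → W.analyticRank = 1 → BSDp W 3

/-- O5 (tame potentially supersingular) at `3`, rank `0` (OPEN): non-CM, `Additive.ClassO5 W 3`,
`ord_{s=1} L(E,s) = 0` ⇒ `BSD(E,3)`. [folklore] -/
@[conjecture] def WAllExclAddTameSSAtThreeRankZero : Prop :=
  ∀ (W : WeierstrassCurve ℚ) [W.IsElliptic] [W.IsGloballyMinimal],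
    ¬ W.HasCM → Additive.ClassO5 W 3 → W.analyticRank = 0 → BSDp W 3

/-- O5 (tame potentially supersingular) at `3`, rank `1` (OPEN): non-CM, `Additive.ClassO5 W 3`,
`ord_{s=1} L(E,s) = 1` ⇒ `BSD(E,3)` — no attacking crux in the tree at `3` in rank `1` (lead line
2026-08-27T05:46:40Z (v)); held residuals only. [folklore] -/
@[conjecture] def WAllExclAddTameSSAtThreeRankOne : Prop :=
  ∀ (W : WeierstrassCurve ℚ) [W.IsElliptic] [W.IsGloballyMinimal],
    ¬ W.HasCM → Additive.ClassO5 W 3 → W.analyticRank = 1 → BSDp W 3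

/-- `(t′)` at `3`, rank `0` (OPEN): non-CM, additive at `3`, `Additive.SubTprime W 3`,
`ord_{s=1} L(E,s) = 0` ⇒ `BSD(E,3)` (K8-t′ items `TameLowerIntrinsicNonCM` / `TameUpperReducibleDefect`
territory). [folklore] -/
@[conjecture] def WAllExclAddTprimeAtThreeRankZero : Prop :=
  ∀ (W : WeierstrassCurve ℚ) [W.IsElliptic] [W.IsGloballyMinimal],
    ¬ W.HasCM → Addv W 3 → Additive.SubTprime W 3 → W.analyticRank = 0 → BSDp W 3

/-- `(t′)` at `3`, rank `1` (OPEN): non-CM, additive at `3`, `Additive.SubTprime W 3`,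
`ord_{s=1} L(E,s) = 1` ⇒ `BSD(E,3)`. BSDp twin at `3` of rung K8-t′'s held residual item 19984
`TameRankOne` (`wAllExclAddTprimeAtThreeRankOne_of_tameRankOne`). [folklore] -/
@[conjecture] def WAllExclAddTprimeAtThreeRankOne : Prop :=
  ∀ (W : WeierstrassCurve ℚ) [W.IsElliptic] [W.IsGloballyMinimal],
    ¬ W.HasCM → Addv W 3 → Additive.SubTprime W 3 → W.analyticRank = 1 → BSDp W 3

/-- O6 (wild, `p = 3` forced) in rank `0` (OPEN): non-CM, `Additive.ClassO6 W 3`,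
`ord_{s=1} L(E,s) = 0` ⇒ `BSD(E,3)` (K9 items `WildLowerIntrinsicNonCM` / `WildUpperReducibleDefect`
territory). [folklore] -/
@[conjecture] def WAllExclAddWildRankZero : Prop :=
  ∀ (W : WeierstrassCurve ℚ) [W.IsElliptic] [W.IsGloballyMinimal],
    ¬ W.HasCM → Additive.ClassO6 W 3 → W.analyticRank = 0 → BSDp W 3

/-- O6 (wild, `p = 3` forced) in rank `1` (OPEN): non-CM, `Additive.ClassO6 W 3`,
`ord_{s=1} L(E,s) = 1` ⇒ `BSD(E,3)`. BSDp twin of rung K9's held residual item 19200 `WildRankOne`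
(`wAllExclAddWildRankOne_of_wildRankOne`). [folklore] -/
@[conjecture] def WAllExclAddWildRankOne : Prop :=
  ∀ (W : WeierstrassCurve ℚ) [W.IsElliptic] [W.IsGloballyMinimal],
    ¬ W.HasCM → Additive.ClassO6 W 3 → W.analyticRank = 1 → BSDp W 3

/-! ### §3. Glue: the `p = 3` slice of row 2 is EXACTLY the conjunction of its cell atoms -/

/-- **Row 2 at `3` ⟺ (M)@3 ∧ (G-ord)@3 ∧ O5@3 ∧ O6** (`Additive.addv_odd_cells W 3`; the wild cell
`WAllExclAddWild` of `TargetAdditive.lean` is a `p = 3` statement, `wAllExclAddWild_of_atThree`).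
[folklore] -/
theorem wAllExclAdditiveAtThree_iff_cellsAtThree :
    WAllExclAdditiveAtThree ↔
      WAllExclAddPotMultAtThree ∧ WAllExclAddPotOrdAtThree ∧ WAllExclAddTameSSAtThree ∧
        WAllExclAddWild := by
  constructor
  · intro h
    exact ⟨fun W _ _ hcm hadd _ hr ↦ h W hcm hadd hr, fun W _ _ hcm hadd _ hr ↦ h W hcm hadd hr,
      fun W _ _ hcm hO hr ↦ h W hcm hO.2.1 hr, wAllExclAddWild_of_atThree h⟩
  · rintro ⟨hM, hG, h5, h6⟩ W _ _ hcm hadd hr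
    rcases Additive.addv_odd_cells W 3 (by decide) hadd with h | h | h | h
    · exact hM W hcm hadd h hr
    · exact hG W hcm hadd h hr
    · exact h5 W hcm h hr
    · exact h6 W 3 hcm h hr

/-- **O5@3 = `(G) ∧ ss`@3 ∪ `(t′)`@3**: `WAllExclAddTameSSAtThree ↔ WAllExclAddGssAtThree ∧
WAllExclAddTprimeAtThree`. [folklore] -/
theorem wAllExclAddTameSSAtThree_iff :
    WAllExclAddTameSSAtThree ↔ WAllExclAddGssAtThree ∧ WAllExclAddTprimeAtThree := by
  constructor
  · intro h
    exact ⟨fun W _ _ hcm hadd hs hr ↦ h W hcm ⟨by decide, hadd, Or.inl hs⟩ hr,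
      fun W _ _ hcm hadd ht hr ↦ h W hcm ⟨by decide, hadd, Or.inr ht⟩ hr⟩
  · rintro ⟨hs, ht⟩ W _ _ hcm hO hr
    obtain ⟨-, hadd, h⟩ := hO
    rcases h with h | h
    · exact hs W hcm hadd h hr
    · exact ht W hcm hadd h hr

/-- (M)@3 ⟺ its two rank atoms (`r ≤ 1 ↔ r = 0 ∨ r = 1`). [folklore] -/
theorem wAllExclAddPotMultAtThree_iff_ranks :
    WAllExclAddPotMultAtThree ↔
      WAllExclAddPotMultAtThreeRankZero ∧ WAllExclAddPotMultAtThreeRankOne :=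
  ⟨fun h ↦ ⟨fun W _ _ hcm hadd hM hr ↦ h W hcm hadd hM (by omega),
      fun W _ _ hcm hadd hM hr ↦ h W hcm hadd hM (by omega)⟩,
    fun ⟨h0, h1⟩ W _ _ hcm hadd hM hr ↦ (Nat.le_one_iff_eq_zero_or_eq_one.mp hr).elim
      (h0 W hcm hadd hM) (h1 W hcm hadd hM)⟩

/-- (G-ord)@3 ⟺ its two rank atoms. [folklore] -/
theorem wAllExclAddPotOrdAtThree_iff_ranks :
    WAllExclAddPotOrdAtThree ↔
      WAllExclAddPotOrdAtThreeRankZero ∧ WAllExclAddPotOrdAtThreeRankOne :=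
  ⟨fun h ↦ ⟨fun W _ _ hcm hadd hG hr ↦ h W hcm hadd hG (by omega),
      fun W _ _ hcm hadd hG hr ↦ h W hcm hadd hG (by omega)⟩,
    fun ⟨h0, h1⟩ W _ _ hcm hadd hG hr ↦ (Nat.le_one_iff_eq_zero_or_eq_one.mp hr).elim
      (h0 W hcm hadd hG) (h1 W hcm hadd hG)⟩

/-- O5@3 ⟺ its two rank atoms. [folklore] -/
theorem wAllExclAddTameSSAtThree_iff_ranks :
    WAllExclAddTameSSAtThree ↔
      WAllExclAddTameSSAtThreeRankZero ∧ WAllExclAddTameSSAtThreeRankOne :=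
  ⟨fun h ↦ ⟨fun W _ _ hcm hO hr ↦ h W hcm hO (by omega), fun W _ _ hcm hO hr ↦ h W hcm hO (by omega)⟩,
    fun ⟨h0, h1⟩ W _ _ hcm hO hr ↦ (Nat.le_one_iff_eq_zero_or_eq_one.mp hr).elim
      (h0 W hcm hO) (h1 W hcm hO)⟩

/-- `(t′)`@3 ⟺ its two rank atoms. [folklore] -/
theorem wAllExclAddTprimeAtThree_iff_ranks :
    WAllExclAddTprimeAtThree ↔
      WAllExclAddTprimeAtThreeRankZero ∧ WAllExclAddTprimeAtThreeRankOne :=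
  ⟨fun h ↦ ⟨fun W _ _ hcm hadd ht hr ↦ h W hcm hadd ht (by omega),
      fun W _ _ hcm hadd ht hr ↦ h W hcm hadd ht (by omega)⟩,
    fun ⟨h0, h1⟩ W _ _ hcm hadd ht hr ↦ (Nat.le_one_iff_eq_zero_or_eq_one.mp hr).elim
      (h0 W hcm hadd ht) (h1 W hcm hadd ht)⟩

/-- **O6 ⟺ its two rank atoms**: the wild cell `WAllExclAddWild` (stated at every `p`, living at
`p = 3` by `wAllExclAddWild_iff_three`) is exactly `WAllExclAddWildRankZero ∧ WAllExclAddWildRankOne`.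
[folklore] -/
theorem wAllExclAddWild_iff_ranks :
    WAllExclAddWild ↔ WAllExclAddWildRankZero ∧ WAllExclAddWildRankOne := by
  rw [wAllExclAddWild_iff_three]
  exact ⟨fun h ↦ ⟨fun W _ _ hcm hO hr ↦ h W hcm hO (by omega), fun W _ _ hcm hO hr ↦ h W hcm hO (by omega)⟩,
    fun ⟨h0, h1⟩ W _ _ hcm hO hr ↦ (Nat.le_one_iff_eq_zero_or_eq_one.mp hr).elim
      (h0 W hcm hO) (h1 W hcm hO)⟩

/-- **Row 2 at `3`, rank `0` ⟺ its four cell atoms** (`WAllExclAdditiveAtThreeRankZero` of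
`TargetPrimeSlices.lean`). [folklore] -/
theorem wAllExclAdditiveAtThreeRankZero_iff_cells :
    WAllExclAdditiveAtThreeRankZero ↔
      WAllExclAddPotMultAtThreeRankZero ∧ WAllExclAddPotOrdAtThreeRankZero ∧
        WAllExclAddTameSSAtThreeRankZero ∧ WAllExclAddWildRankZero := by
  constructor
  · intro h
    exact ⟨fun W _ _ hcm hadd _ hr ↦ h W hcm hadd hr, fun W _ _ hcm hadd _ hr ↦ h W hcm hadd hr,
      fun W _ _ hcm hO hr ↦ h W hcm hO.2.1 hr, fun W _ _ hcm hO hr ↦ h W hcm hO.2.1 hr⟩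
  · rintro ⟨hM, hG, h5, h6⟩ W _ _ hcm hadd hr
    rcases Additive.addv_odd_cells W 3 (by decide) hadd with h | h | h | h
    · exact hM W hcm hadd h hr
    · exact hG W hcm hadd h hr
    · exact h5 W hcm h hr
    · exact h6 W hcm h hr

/-- **Row 2 at `3`, rank `1` ⟺ its four cell atoms** (`WAllExclAdditiveAtThreeRankOne`). [folklore] -/
theorem wAllExclAdditiveAtThreeRankOne_iff_cells :
    WAllExclAdditiveAtThreeRankOne ↔
      WAllExclAddPotMultAtThreeRankOne ∧ WAllExclAddPotOrdAtThreeRankOne ∧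
        WAllExclAddTameSSAtThreeRankOne ∧ WAllExclAddWildRankOne := by
  constructor
  · intro h
    exact ⟨fun W _ _ hcm hadd _ hr ↦ h W hcm hadd hr, fun W _ _ hcm hadd _ hr ↦ h W hcm hadd hr,
      fun W _ _ hcm hO hr ↦ h W hcm hO.2.1 hr, fun W _ _ hcm hO hr ↦ h W hcm hO.2.1 hr⟩
  · rintro ⟨hM, hG, h5, h6⟩ W _ _ hcm hadd hr
    rcases Additive.addv_odd_cells W 3 (by decide) hadd with h | h | h | h
    · exact hM W hcm hadd h hr
    · exact hG W hcm hadd h hr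
    · exact h5 W hcm h hr
    · exact h6 W hcm h hr

/-- **Row 2 at `3` ⟺ its eight cell × rank atoms.** [folklore] -/
theorem wAllExclAdditiveAtThree_iff_cellRankAtoms :
    WAllExclAdditiveAtThree ↔
      (WAllExclAddPotMultAtThreeRankZero ∧ WAllExclAddPotOrdAtThreeRankZero ∧
          WAllExclAddTameSSAtThreeRankZero ∧ WAllExclAddWildRankZero) ∧
        (WAllExclAddPotMultAtThreeRankOne ∧ WAllExclAddPotOrdAtThreeRankOne ∧
          WAllExclAddTameSSAtThreeRankOne ∧ WAllExclAddWildRankOne) := by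
  rw [wAllExclAdditiveAtThree_iff_ranks, wAllExclAdditiveAtThreeRankZero_iff_cells,
    wAllExclAdditiveAtThreeRankOne_iff_cells]

/-- **Row 2 ⟺ (its four cells at `3`) ∧ (its `p ≥ 5` slice).** [folklore] -/
theorem wAllExclAdditive_iff_cellsAtThree_fiveLe :
    WAllExclAdditive ↔
      (WAllExclAddPotMultAtThree ∧ WAllExclAddPotOrdAtThree ∧ WAllExclAddTameSSAtThree ∧
          WAllExclAddWild) ∧ WAllExclAdditiveFiveLe := by
  rw [wAllExclAdditive_iff_three_fiveLe, wAllExclAdditiveAtThree_iff_cellsAtThree]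

/-- O5@3 in rank `1` from its two branches: `(G) ∧ ss`@3 (rank `≤ 1`) and `(t′)`@3 in rank `1` —
the BSDp twins of the held residual items 19120 and 19984. [folklore] -/
theorem wAllExclAddTameSSAtThreeRankOne_of_gss_of_tprimeRankOne (hs : WAllExclAddGssAtThree)
    (ht : WAllExclAddTprimeAtThreeRankOne) : WAllExclAddTameSSAtThreeRankOne := by
  intro W _ _ hcm hO hr
  obtain ⟨-, hadd, h⟩ := hO
  rcases h with h | h
  · exact hs W hcm hadd h (by omega)
  · exact ht W hcm hadd h hr

/-- O5@3 in rank `0` from `(G) ∧ ss`@3 (rank `≤ 1`) and `(t′)`@3 in rank `0`. [folklore] -/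
theorem wAllExclAddTameSSAtThreeRankZero_of_gss_of_tprimeRankZero (hs : WAllExclAddGssAtThree)
    (ht : WAllExclAddTprimeAtThreeRankZero) : WAllExclAddTameSSAtThreeRankZero := by
  intro W _ _ hcm hO hr
  obtain ⟨-, hadd, h⟩ := hO
  rcases h with h | h
  · exact hs W hcm hadd h (by omega)
  · exact ht W hcm hadd h hr

/-! ### §4. Each cell slice at `3` is the `p = 3` instance of its cell leaf (`TargetAdditive.lean`) -/

/-- (M)@3 ⇐ `WAllExclAddPotMult`. [folklore] -/
theorem wAllExclAddPotMultAtThree_of_potMult (h : WAllExclAddPotMult) : WAllExclAddPotMultAtThree :=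
  fun W _ _ hcm hadd hM hr ↦ h W 3 hcm (by decide) hadd hM hr

/-- (G-ord)@3 ⇐ `WAllExclAddPotOrd`. [folklore] -/
theorem wAllExclAddPotOrdAtThree_of_potOrd (h : WAllExclAddPotOrd) : WAllExclAddPotOrdAtThree :=
  fun W _ _ hcm hadd hG hr ↦ h W 3 hcm (by decide) hadd hG hr

/-- O5@3 ⇐ `WAllExclAddTameSS` (hence ⇐ the class target `Additive.O5.Statement`,
`wAllExclAddTameSS_of_statement`). [folklore] -/
theorem wAllExclAddTameSSAtThree_of_tameSS (h : WAllExclAddTameSS) : WAllExclAddTameSSAtThree :=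
  fun W _ _ hcm hO hr ↦ h W 3 hcm hO hr

/-- `(G) ∧ ss`@3 ⇐ `WAllExclAddGss`. [folklore] -/
theorem wAllExclAddGssAtThree_of_gss (h : WAllExclAddGss) : WAllExclAddGssAtThree :=
  fun W _ _ hcm hadd hs hr ↦ h W 3 hcm (by decide) hadd hs hr

/-- `(t′)`@3 ⇐ `WAllExclAddTprime`. [folklore] -/
theorem wAllExclAddTprimeAtThree_of_tprime (h : WAllExclAddTprime) : WAllExclAddTprimeAtThree :=
  fun W _ _ hcm hadd ht hr ↦ h W 3 hcm (by decide) hadd ht hr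

/-- Every block of this file follows from `WAll` (each is an instance of it): registering any of
them as a closed-rung leaf neither loses nor adds anything. [folklore] -/
theorem cellsAtThree_of_wAll (h : WAll) :
    (WAllExclAddPotMultAtThree ∧ WAllExclAddPotOrdAtThree ∧ WAllExclAddTameSSAtThree ∧
        WAllExclAddGssAtThree ∧ WAllExclAddTprimeAtThree) ∧
      (WAllExclAddPotMultAtThreeRankZero ∧ WAllExclAddPotOrdAtThreeRankZero ∧
        WAllExclAddTameSSAtThreeRankZero ∧ WAllExclAddTprimeAtThreeRankZero ∧
          WAllExclAddWildRankZero) ∧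
      (WAllExclAddPotMultAtThreeRankOne ∧ WAllExclAddPotOrdAtThreeRankOne ∧
        WAllExclAddTameSSAtThreeRankOne ∧ WAllExclAddTprimeAtThreeRankOne ∧
          WAllExclAddWildRankOne) :=
  ⟨⟨fun W _ _ _ _ _ hr ↦ h W 3 hr, fun W _ _ _ _ _ hr ↦ h W 3 hr, fun W _ _ _ _ hr ↦ h W 3 hr,
      fun W _ _ _ _ _ hr ↦ h W 3 hr, fun W _ _ _ _ _ hr ↦ h W 3 hr⟩,
    ⟨fun W _ _ _ _ _ hr ↦ h W 3 (by omega), fun W _ _ _ _ _ hr ↦ h W 3 (by omega),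
      fun W _ _ _ _ hr ↦ h W 3 (by omega), fun W _ _ _ _ _ hr ↦ h W 3 (by omega),
      fun W _ _ _ _ hr ↦ h W 3 (by omega)⟩,
    ⟨fun W _ _ _ _ _ hr ↦ h W 3 (by omega), fun W _ _ _ _ _ hr ↦ h W 3 (by omega),
      fun W _ _ _ _ hr ↦ h W 3 (by omega), fun W _ _ _ _ _ hr ↦ h W 3 (by omega),
      fun W _ _ _ _ hr ↦ h W 3 (by omega)⟩⟩

/-! ### §5. The held residual items at `3` (`Typed.MissingPPartAt` currency) close their BSDp twins -/

/-- **`(G) ∧ ss` at `3` ⇐ item 19120 `Gss2AtThree` (rung K8, held residual; shape verbatim) + GZK.**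
[folklore] -/
theorem wAllExclAddGssAtThree_of_gss2AtThree
    (h : ∀ (W : WeierstrassCurve ℚ) [W.IsElliptic] [W.IsGloballyMinimal] [Fact (3 : ℕ).Prime],
      W.analyticRank ≤ 1 → Addv W 3 → Additive.SubGss W 3 → Typed.MissingPPartAt W 3)
    (hGZK : rank_eq_analyticRank_of_analyticRank_le_one) : WAllExclAddGssAtThree :=
  fun W _ _ _ hadd hs hr ↦ Typed.bsdp_of_missingPPartAt W 3 hGZK hr (h W hr hadd hs)

/-- **O6 in rank `1` ⇐ item 19200 `WildRankOne` (rung K9, held residual; shape verbatim) + GZK.**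
[folklore] -/
theorem wAllExclAddWildRankOne_of_wildRankOne
    (h : ∀ (W : WeierstrassCurve ℚ) [W.IsElliptic] [W.IsGloballyMinimal] [Fact (3 : ℕ).Prime],
      W.analyticRank = 1 → Additive.ClassO6 W 3 → Typed.MissingPPartAt W 3)
    (hGZK : rank_eq_analyticRank_of_analyticRank_le_one) : WAllExclAddWildRankOne :=
  fun W _ _ _ hO hr ↦ Typed.bsdp_of_missingPPartAt W 3 hGZK (by omega) (h W hr hO)

/-- **`(t′)` at `3` in rank `1` ⇐ item 19984 `TameRankOne` (rung K8-t′, held residual, stated at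
every odd `p`; shape verbatim) + GZK** — its `p = 3` instance. [folklore] -/
theorem wAllExclAddTprimeAtThreeRankOne_of_tameRankOne
    (h : ∀ (W : WeierstrassCurve ℚ) [W.IsElliptic] [W.IsGloballyMinimal] (p : ℕ) [Fact p.Prime],
      W.analyticRank = 1 → p ≠ 2 → Addv W p → Additive.SubTprime W p → Typed.MissingPPartAt W p)
    (hGZK : rank_eq_analyticRank_of_analyticRank_le_one) : WAllExclAddTprimeAtThreeRankOne :=
  fun W _ _ _ hadd ht hr ↦
    Typed.bsdp_of_missingPPartAt W 3 hGZK (by omega) (h W 3 hr (by decide) hadd ht)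

end Summit.BirchSwinnertonDyer

end
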